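import Literature.NumberTheory.EllipticCurves.ShaIsogenyProofs
import Literature.NumberTheory.EllipticCurves.SelmerCorankProofs
import Literature.NumberTheory.EllipticCurves.IsogenyQuadraticTwistProofs
import HarnessLib

/-!
# Isogenies on `H¹(K, E[p^∞])` and on `Sel_{p^∞}(E/K)`; the divisible part of `Sel_{p^∞}`

Topic `NumberTheory/EllipticCurves`. Definitions (with their unfolding / functoriality API) used
by A. Smith, *The Birch and Swinnerton-Dyer conjecture implies Goldfeld's conjecture*,
arXiv:2503.17619 (2025), §1.2 "Isogeny tricks" (Def. 1.16, Prop. 1.18), stated for an arbitrary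
Weierstrass curve over a field `K` (a number field where Selmer groups enter) and a prime `p`:

* `primaryTorsionMap p f : E[p^∞] →+ E'[p^∞]` — the restriction to `p`-primary torsion of a
  homomorphism of geometric points `f : E(K̄) →+ E'(K̄)` (an isogeny `φ` over `K`:
  `φ.toAddMonoidHom`); `Γ_K`-equivariant when `f` is (`primaryTorsionMap_smul`).
* `galH1PrimaryMap p f hf : H¹(K, E[p^∞]) →+ H¹(K, E'[p^∞])` — the induced map `φ_*` on
  continuous Galois cohomology (the tree's `resH1Hom` = Mathlib's `ContinuousCohomology.map` for
  the compatible pair `(id_{Γ_K}, f|_{E[p^∞]})`), with: its value on explicit cocycles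
  (`galH1PrimaryMap_oneCocycleClass`), functoriality (`galH1PrimaryMap_galH1PrimaryMap`),
  `ψ_* ∘ φ_* = n` when `ψ ∘ φ = [n]` (`galH1PrimaryMap_galH1PrimaryMap_of_comp_eq_nsmul`),
  naturality with `H¹(K, E[p^∞]) → H¹(K, E)` (`primaryH1ToH1_galH1PrimaryMap`), and — over a
  number field, for `f` with local points maps (every isogeny: `Isogeny.hasLocalPointsMaps_toAddMonoidHom`)
  — `φ_* (Sel_{p^∞}(E/K)) ⊆ Sel_{p^∞}(E'/K)` (`galH1PrimaryMap_mem_selmerGroupPInfty`), packaged as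
  `selmerPInftyMap : Sel_{p^∞}(E/K) →+ Sel_{p^∞}(E'/K)`. This is the map
  "`Sel^{2^∞} E^d →(φ) Sel^{2^∞} E_0^d`" of Smith's proof of Prop. 1.18.
* `selmerDivisiblePart W p = ⋂_k p^k · Sel_{p^∞}(E/K)` — "the subgroup of divisible elements in
  the `2^∞`-Selmer group" (Smith, Def. 1.16, `Sel^{2^∞}_{div}`), for any `p`.
* `selmerDivRank p f hf = dim_{𝔽_p} ((Sel_div ⊓ ker φ_*)[p])` — Smith's `r_{φ,div}(E)` (Def. 1.16:
  `dim_{𝔽_2} im(H¹(G_ℚ, E[φ]) → H¹(G_ℚ, E[2^∞])) ∩ Sel^{2^∞}_{div} E`), written with `ker φ_*` in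
  place of `im (H¹(K, E[φ]) → H¹(K, E[p^∞]))`; that these agree (exactness of
  `H¹(K, E[φ]) → H¹(K, E[p^∞]) → H¹(K, E_0[p^∞])`, the first line of Smith's proof of Prop. 1.18)
  is proved in the companion `…Proofs` file, together with everything else about these objects
  (`Sel_div = p^K Sel` for large `K`, divisibility, `#Sel_div[p] = p^{corank}`, Prop. 1.18).

Theorems here are only the definitional API. No named facts.

## References

* A. Smith, arXiv:2503.17619 (2025), §1.2: Def. 1.16, Prop. 1.18 (and its proof). [arXiv250317619]
* J. S. Milne, *Arithmetic Duality Theorems*, 2nd ed. (2006), I.§6–§7 (functoriality of `H¹`,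
  `Sel`, `Ш` in the coefficient module). [MilneADT2006]
* J.-P. Serre, *Galois Cohomology* (1997), I.§2.4 (compatible pairs). [SerreGaloisCohomology1997]

## Design notes

* Same generality and shape as `ShaIsogeny.lean` (`galH1Map`, `shaMap`): an equivariant
  `f : E(K̄) →+ E'(K̄)` plus, for the Selmer statements, `HasLocalPointsMaps W W' f`.
* Group-wide rules of `Selmer`/`ShaIsogeny`: `noncomputable section`, `open scoped Classical`, one
  universe `u`.
-/

noncomputable section

open scoped Classical
open scoped AddSubgroup

universe u

namespace Literature.NumberTheory.EllipticCurves

open WeierstrassCurve Literature.NumberTheory.GaloisRepresentations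

/-! ## `f` on `p`-primary torsion and on `H¹(K, E[p^∞])` -/

section Primary

variable {K : Type u} [Field K] {W W' W'' : WeierstrassCurve K} (p : ℕ)

/-- **`f|_{E[p^∞]} : E[p^∞] →+ E'[p^∞]`**: a homomorphism of geometric points maps `p`-primary
torsion to `p`-primary torsion (`p^k P = 0 ⇒ p^k f(P) = 0`). For an isogeny `φ : E → E_0` this is
"the associated map on `E[2^∞]`" of Smith, arXiv:2503.17619, §1.2. [folklore] -/
def primaryTorsionMap (f : W.geomPoints →+ W'.geomPoints) :
    geomPrimaryTorsion W p →+ geomPrimaryTorsion W' p :=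
  (f.comp (geomPrimaryTorsion W p).subtype).codRestrict (geomPrimaryTorsion W' p) fun P ↦ by
    obtain ⟨k, hk⟩ := (AddCommGroup.mem_primaryComponent).mp P.2
    exact (AddCommGroup.mem_primaryComponent).mpr ⟨k, by
      rw [AddMonoidHom.comp_apply, AddSubgroup.coe_subtype, ← map_nsmul, hk, map_zero]⟩

/-- Unfolding `primaryTorsionMap` on the underlying points. [folklore] -/
@[simp]
theorem coe_primaryTorsionMap_apply (f : W.geomPoints →+ W'.geomPoints)
    (P : geomPrimaryTorsion W p) : ((primaryTorsionMap p f P : geomPrimaryTorsion W' p) :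
      W'.geomPoints) = f P :=
  rfl

/-- `primaryTorsionMap` is `Γ_K`-equivariant when `f` is. [folklore] -/
theorem primaryTorsionMap_smul (f : W.geomPoints →+ W'.geomPoints)
    (hf : ∀ (σ : Field.absoluteGaloisGroup K) (P : W.geomPoints), f (σ • P) = σ • f P)
    (σ : Field.absoluteGaloisGroup K) (P : geomPrimaryTorsion W p) :
    primaryTorsionMap p f (σ • P) = σ • primaryTorsionMap p f P :=
  Subtype.ext (by
    rw [coe_primaryTorsionMap_apply, primaryComponent.coe_smul, primaryComponent.coe_smul,
      coe_primaryTorsionMap_apply, hf])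

/-- `primaryTorsionMap` of a composite is the composite. [folklore] -/
theorem primaryTorsionMap_comp (f : W.geomPoints →+ W'.geomPoints)
    (g : W'.geomPoints →+ W''.geomPoints) :
    primaryTorsionMap p (g.comp f) = (primaryTorsionMap p g).comp (primaryTorsionMap p f) :=
  AddMonoidHom.ext fun _ ↦ Subtype.ext rfl

/-- If `g (f P) = n • P` on `E(K̄)` then the same holds on `E[p^∞]`. [folklore] -/
theorem primaryTorsionMap_primaryTorsionMap_of_comp_eq_nsmul (f : W.geomPoints →+ W'.geomPoints)
    (g : W'.geomPoints →+ W.geomPoints) {n : ℕ} (h : ∀ P : W.geomPoints, g (f P) = (n : ℤ) • P)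
    (P : geomPrimaryTorsion W p) :
    primaryTorsionMap p g (primaryTorsionMap p f P) = n • P :=
  Subtype.ext (by
    rw [coe_primaryTorsionMap_apply, coe_primaryTorsionMap_apply, h, AddSubgroupClass.coe_nsmul,
      natCast_zsmul])

/-- **`φ_* : H¹(K, E[p^∞]) →+ H¹(K, E'[p^∞])`**, the map induced on continuous Galois cohomology by
a `Γ_K`-equivariant homomorphism of geometric points `f : E(K̄) →+ E'(K̄)` restricted to `E[p^∞]`
(the tree's `resH1Hom`, Mathlib's `ContinuousCohomology.map`, for the compatible pair
`(id_{Γ_K}, f|_{E[p^∞]})`). For an isogeny `φ` and `p = 2` this is the map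
`H¹(G_ℚ, E^d[2^∞]) → H¹(G_ℚ, E_0^d[2^∞])` of Smith, arXiv:2503.17619, proof of Prop. 1.18.
Milne, *ADT*, I.§6; Serre, *Galois Cohomology*, I.§2.4. [folklore] -/
def galH1PrimaryMap (f : W.geomPoints →+ W'.geomPoints)
    (hf : ∀ (σ : Field.absoluteGaloisGroup K) (P : W.geomPoints), f (σ • P) = σ • f P) :
    galH1Primary W p →+ galH1Primary W' p :=
  resH1Hom (ContinuousMonoidHom.id (Field.absoluteGaloisGroup K)) (primaryTorsionMap p f)
    (primaryTorsionMap_smul p f hf)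

/-- `φ_*` on explicit cocycles: `φ_* [a] = [f ∘ a]`. Serre, *Galois Cohomology*, I.§2.4.
[folklore] -/
theorem galH1PrimaryMap_oneCocycleClass (f : W.geomPoints →+ W'.geomPoints)
    (hf : ∀ (σ : Field.absoluteGaloisGroup K) (P : W.geomPoints), f (σ • P) = σ • f P)
    (a : contOneCocycles (discreteTopRep (Field.absoluteGaloisGroup K) (geomPrimaryTorsion W p))) :
    galH1PrimaryMap p f hf (oneCocycleClass _ a) =
      oneCocycleClass _ (contOneCocycles.push (primaryTorsionMap p f)
        (primaryTorsionMap_smul p f hf) a) :=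
  resH1Hom_id_oneCocycleClass _ _ a

/-- **Functoriality**: `ψ_* (φ_* c) = (ψ ∘ φ)_* c`. Serre, *Galois Cohomology*, I.§2.4.
[folklore] -/
theorem galH1PrimaryMap_galH1PrimaryMap (f : W.geomPoints →+ W'.geomPoints)
    (hf : ∀ (σ : Field.absoluteGaloisGroup K) (P : W.geomPoints), f (σ • P) = σ • f P)
    (g : W'.geomPoints →+ W''.geomPoints)
    (hg : ∀ (σ : Field.absoluteGaloisGroup K) (Q : W'.geomPoints), g (σ • Q) = σ • g Q)
    (c : galH1Primary W p) :
    galH1PrimaryMap p g hg (galH1PrimaryMap p f hf c) =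
      galH1PrimaryMap p (g.comp f) (fun σ P ↦ by simp [hf, hg]) c := by
  change ((galH1PrimaryMap p g hg).comp (galH1PrimaryMap p f hf)) c = _
  unfold galH1PrimaryMap
  rw [resH1Hom_comp]
  exact congrArg (fun F : galH1Primary W p →+ galH1Primary W'' p ↦ F c)
    (resH1Hom_congr (by ext; rfl) (by rw [primaryTorsionMap_comp]) _ _)

/-- **`ψ ∘ φ = [n]` implies `ψ_* ∘ φ_* = n` on `H¹(K, E[p^∞])`** (an isogeny and its dual,
`n = deg φ`; Silverman, *AEC*, III.6.1(a)): computed on cocycles, `[g ∘ f ∘ a] = [n • a] = n • [a]`.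
Milne, *ADT*, proof of Lemma I.7.1(b); Smith, arXiv:2503.17619, proof of Prop. 1.18 ("we may
decompose the multiplication by `2` map … as the composition"). [folklore] -/
theorem galH1PrimaryMap_galH1PrimaryMap_of_comp_eq_nsmul (f : W.geomPoints →+ W'.geomPoints)
    (hf : ∀ (σ : Field.absoluteGaloisGroup K) (P : W.geomPoints), f (σ • P) = σ • f P)
    (g : W'.geomPoints →+ W.geomPoints)
    (hg : ∀ (σ : Field.absoluteGaloisGroup K) (Q : W'.geomPoints), g (σ • Q) = σ • g Q)
    {n : ℕ} (h : ∀ P : W.geomPoints, g (f P) = (n : ℤ) • P) (c : galH1Primary W p) :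
    galH1PrimaryMap p g hg (galH1PrimaryMap p f hf c) = n • c := by
  obtain ⟨a, rfl⟩ := oneCocycleClass_surjective _ c
  rw [galH1PrimaryMap_oneCocycleClass, galH1PrimaryMap_oneCocycleClass]
  have hs := oneCocycleClass_smul
    (discreteTopRep (Field.absoluteGaloisGroup K) (geomPrimaryTorsion W p)) (n : ℤ) a
  conv at hs => rhs; rw [Nat.cast_smul_eq_nsmul]
  rw [← hs]
  congr 1
  apply Subtype.ext
  ext1 σ
  change primaryTorsionMap p g (primaryTorsionMap p f (a.1 σ)) = ((n : ℤ) • a.1) σ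
  rw [primaryTorsionMap_primaryTorsionMap_of_comp_eq_nsmul p f g h, ContinuousMap.smul_apply,
    natCast_zsmul]

/-- **The kernel of `φ_*` is killed by `n`** when `ψ ∘ φ = [n]`. [folklore] -/
theorem nsmul_eq_zero_of_galH1PrimaryMap_eq_zero (f : W.geomPoints →+ W'.geomPoints)
    (hf : ∀ (σ : Field.absoluteGaloisGroup K) (P : W.geomPoints), f (σ • P) = σ • f P)
    (g : W'.geomPoints →+ W.geomPoints)
    (hg : ∀ (σ : Field.absoluteGaloisGroup K) (Q : W'.geomPoints), g (σ • Q) = σ • g Q)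
    {n : ℕ} (h : ∀ P : W.geomPoints, g (f P) = (n : ℤ) • P) {c : galH1Primary W p}
    (hc : galH1PrimaryMap p f hf c = 0) : n • c = 0 := by
  rw [← galH1PrimaryMap_galH1PrimaryMap_of_comp_eq_nsmul p f hf g hg h c, hc, map_zero]

/-- **Naturality with `H¹(K, E[p^∞]) → H¹(K, E)`**: the square
`H¹(K, E[p^∞]) →(φ_*) H¹(K, E'[p^∞])`, `H¹(K, E) →(H¹(f)) H¹(K, E')` commutes with the two maps
`primaryH1ToH1` (both composites are `resH1Hom` of the pair `(id, f ∘ (E[p^∞] ↪ E(K̄)))`).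
Serre, *Galois Cohomology*, I.§2.4. [folklore] -/
theorem primaryH1ToH1_galH1PrimaryMap (f : W.geomPoints →+ W'.geomPoints)
    (hf : ∀ (σ : Field.absoluteGaloisGroup K) (P : W.geomPoints), f (σ • P) = σ • f P)
    (c : galH1Primary W p) :
    primaryH1ToH1 W' p (galH1PrimaryMap p f hf c) = galH1Map f hf (primaryH1ToH1 W p c) := by
  change ((primaryH1ToH1 W' p).comp (galH1PrimaryMap p f hf)) c =
    ((galH1Map f hf).comp (primaryH1ToH1 W p)) c
  unfold primaryH1ToH1 galH1PrimaryMap galH1Map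
  rw [resH1Hom_comp, resH1Hom_comp]
  exact congrArg (fun F : galH1Primary W p →+ W'.galH1 ↦ F c)
    (resH1Hom_congr rfl (by ext; rfl) _ _)

variable (E : Type u) [Field E] [Algebra K E]

/-- **`φ_*` respects the `p^∞`-Selmer local conditions.** If `f` extends to a `Γ_E`-equivariant
map of local points `f_E : E(K̄_E) → E'(K̄_E)` compatible with the chosen embedding `K̄ → K̄_E`,
then `φ_*` maps `ker (H¹(K, E[p^∞]) → H¹(E, E))` into `ker (H¹(K, E'[p^∞]) → H¹(E, E'))`
(both paths `H¹(K, E[p^∞]) → H¹(E, E')` are `resH1Hom` of one compatible pair;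
cf. `galH1Map_mem_localRestrictionKer`). Milne, *ADT*, I.§6. [folklore] -/
theorem galH1PrimaryMap_mem_selmerLocalKerPrimary (f : W.geomPoints →+ W'.geomPoints)
    (hf : ∀ (σ : Field.absoluteGaloisGroup K) (P : W.geomPoints), f (σ • P) = σ • f P)
    (fE : localPoints W E →+ localPoints W' E)
    (hfE : ∀ (τ : Field.absoluteGaloisGroup E) (P : localPoints W E), fE (τ • P) = τ • fE P)
    (hcomp : ∀ P : W.geomPoints, fE (pointsMap W E P) = pointsMap W' E (f P))
    {c : galH1Primary W p} (hc : c ∈ selmerLocalKerPrimary W E p) :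
    galH1PrimaryMap p f hf c ∈ selmerLocalKerPrimary W' E p := by
  rw [selmerLocalKerPrimary, resKer_eq_ker, AddMonoidHom.mem_ker] at hc ⊢
  have key : (resH1Hom (resGal (K := K) E)
      ((pointsMap W' E).comp (geomPrimaryTorsion W' p).subtype) (fun σ P ↦ by
        simp only [AddMonoidHom.coe_comp, AddSubgroup.coe_subtype, Function.comp_apply,
          primaryComponent.coe_smul]
        exact pointsMap_smul W' E σ P)).comp (galH1PrimaryMap p f hf) =
      (resH1Hom (ContinuousMonoidHom.id (Field.absoluteGaloisGroup E)) fE hfE).comp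
        (resH1Hom (resGal (K := K) E)
          ((pointsMap W E).comp (geomPrimaryTorsion W p).subtype) (fun σ P ↦ by
            simp only [AddMonoidHom.coe_comp, AddSubgroup.coe_subtype, Function.comp_apply,
              primaryComponent.coe_smul]
            exact pointsMap_smul W E σ P)) := by
    unfold galH1PrimaryMap
    rw [resH1Hom_comp, resH1Hom_comp]
    exact resH1Hom_congr (by ext; rfl) (by ext P; exact (hcomp P).symm) _ _
  have hkey := congrArg (fun F : galH1Primary W p →+ localH1 W' E ↦ F c) key
  simp only [AddMonoidHom.comp_apply] at hkey
  rw [hkey, hc, map_zero]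

end Primary

/-! ## `φ_*` on `Sel_{p^∞}` over a number field -/

section NumberField

open NumberField IsDedekindDomain

variable {K : Type u} [Field K] [NumberField K] {W W' : WeierstrassCurve K} (p : ℕ)

/-- **`φ_* (Sel_{p^∞}(E/K)) ⊆ Sel_{p^∞}(E'/K)`** for `f` with local points maps (every isogeny
over `K`: `Isogeny.hasLocalPointsMaps_toAddMonoidHom`): the local condition at every finite and
every infinite place is respected (`galH1PrimaryMap_mem_selmerLocalKerPrimary`). This is the map
`Sel^{2^∞} E^d →(φ) Sel^{2^∞} E_0^d` of Smith, arXiv:2503.17619, proof of Prop. 1.18; Milne,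
*ADT*, I.§6–§7. [folklore] -/
theorem galH1PrimaryMap_mem_selmerGroupPInfty (f : W.geomPoints →+ W'.geomPoints)
    (hf : ∀ (σ : Field.absoluteGaloisGroup K) (P : W.geomPoints), f (σ • P) = σ • f P)
    (hloc : HasLocalPointsMaps W W' f) {c : galH1Primary W p} (hc : c ∈ selmerGroupPInfty W p) :
    galH1PrimaryMap p f hf c ∈ selmerGroupPInfty W' p := by
  simp only [selmerGroupPInfty, AddSubgroup.mem_inf, AddSubgroup.mem_iInf] at hc ⊢
  refine ⟨fun v ↦ ?_, fun w ↦ ?_⟩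
  · obtain ⟨fE, hfE, hcomp⟩ := hloc (v.adicCompletion K)
    exact galH1PrimaryMap_mem_selmerLocalKerPrimary p _ f hf fE hfE hcomp (hc.1 v)
  · obtain ⟨fE, hfE, hcomp⟩ := hloc w.Completion
    exact galH1PrimaryMap_mem_selmerLocalKerPrimary p _ f hf fE hfE hcomp (hc.2 w)

/-- **`Sel_{p^∞}(f) : Sel_{p^∞}(E/K) →+ Sel_{p^∞}(E'/K)`**, the restriction of `φ_*`
(for `f` with local points maps). Smith, arXiv:2503.17619, proof of Prop. 1.18; Milne, *ADT*,
I.§6–§7. [folklore] -/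
def selmerPInftyMap (f : W.geomPoints →+ W'.geomPoints)
    (hf : ∀ (σ : Field.absoluteGaloisGroup K) (P : W.geomPoints), f (σ • P) = σ • f P)
    (hloc : HasLocalPointsMaps W W' f) : selmerGroupPInfty W p →+ selmerGroupPInfty W' p :=
  ((galH1PrimaryMap p f hf).comp (selmerGroupPInfty W p).subtype).codRestrict _ fun c ↦
    galH1PrimaryMap_mem_selmerGroupPInfty p f hf hloc c.2

/-- Unfolding `selmerPInftyMap`: it is `φ_*` on the underlying classes. [folklore] -/
@[simp]
theorem coe_selmerPInftyMap_apply (f : W.geomPoints →+ W'.geomPoints)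
    (hf : ∀ (σ : Field.absoluteGaloisGroup K) (P : W.geomPoints), f (σ • P) = σ • f P)
    (hloc : HasLocalPointsMaps W W' f) (c : selmerGroupPInfty W p) :
    (selmerPInftyMap p f hf hloc c : galH1Primary W' p) = galH1PrimaryMap p f hf c :=
  rfl

/-! ## The divisible part of `Sel_{p^∞}` and Smith's `r_{φ,div}` -/

variable (W)

/-- **`Sel^{p^∞}_{div}(E/K) = ⋂_{k ≥ 0} p^k · Sel_{p^∞}(E/K)`**, "the subgroup of divisible
elements in the `2^∞`-Selmer group" (Smith, arXiv:2503.17619, Def. 1.16, `Sel^{2^∞}_{div} E^d`),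
for any prime `p`: an element of the (`p`-primary) group `Sel_{p^∞}` is divisible by every
`n ≥ 1` inside `Sel_{p^∞}` iff it is divisible by every power of `p` (the prime-to-`p` part of
`n` acts invertibly), i.e. iff it lies in every `p^k Sel_{p^∞}`. Since `Sel_{p^∞}[p]` is finite,
the chain `p^k Sel_{p^∞}` is eventually constant and this subgroup is the maximal divisible
subgroup `≅ (ℚ_p/ℤ_p)^{corank}` (proved in the companion `…Proofs` file). As an `AddSubgroup`
of `H¹(K, E[p^∞])`, contained in `Sel_{p^∞}(E/K)` (the term `k = 0`).
[cite: arXiv250317619, Def. 1.16] -/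
def selmerDivisiblePart : AddSubgroup (galH1Primary W p) :=
  ⨅ k : ℕ, (selmerGroupPInfty W p).map (nsmulAddMonoidHom (p ^ k))

/-- Membership in `Sel_div`: `c ∈ Sel_div ↔ ∀ k, ∃ s ∈ Sel_{p^∞}, p^k • s = c`. [folklore] -/
theorem mem_selmerDivisiblePart_iff (c : galH1Primary W p) :
    c ∈ selmerDivisiblePart W p ↔ ∀ k : ℕ, ∃ s ∈ selmerGroupPInfty W p, p ^ k • s = c := by
  simp only [selmerDivisiblePart, AddSubgroup.mem_iInf, AddSubgroup.mem_map,
    nsmulAddMonoidHom_apply]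

/-- `Sel_div ⊆ Sel_{p^∞}` (the term `k = 0` of the intersection). [folklore] -/
theorem selmerDivisiblePart_le : selmerDivisiblePart W p ≤ selmerGroupPInfty W p := fun c hc ↦ by
  obtain ⟨s, hs, rfl⟩ := (mem_selmerDivisiblePart_iff W p c).mp hc 0
  rwa [pow_zero, one_smul]

/-- `Sel_div ⊆ p^k Sel_{p^∞}` for every `k`. [folklore] -/
theorem selmerDivisiblePart_le_map (k : ℕ) :
    selmerDivisiblePart W p ≤ (selmerGroupPInfty W p).map (nsmulAddMonoidHom (p ^ k)) :=
  iInf_le _ k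

variable {W}

/-- **Smith's `r_{φ,div}`** (arXiv:2503.17619, Def. 1.16: for a degree-`2` `ℚ`-isogeny
`φ : E → E_0`, `r_{φ,div}(E^d) = dim_{𝔽_2} im(H¹(G_ℚ, E[φ]) → H¹(G_ℚ, E^d[2^∞])) ∩ Sel^{2^∞}_{div} E^d`),
for a `Γ_K`-equivariant `f : E(K̄) →+ E'(K̄)` and a prime `p`: the `𝔽_p`-dimension of the
`p`-torsion of `Sel^{p^∞}_{div}(E/K) ∩ ker (φ_* : H¹(K, E[p^∞]) → H¹(K, E'[p^∞]))`. For an isogeny of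
degree `p` (Smith: `p = 2`, `deg φ = 2`) the group `Sel_div ∩ ker φ_*` is already killed by `p`
and `ker φ_* = im (H¹(K, E[φ]) → H¹(K, E[p^∞]))` (exactness of the cohomology sequence of
`0 → E[φ] → E[p^∞] →(φ) E'[p^∞] → 0`, the first step of Smith's proof of Prop. 1.18), so this is
the printed `r_{φ,div}`; both facts are theorems of the companion `…Proofs` file. Applied to the
twist `E^d` and the twisted isogeny `φ^d` (`Isogeny.quadraticTwist`) it is `r_{φ,div}(E^d)`.
[cite: arXiv250317619, Def. 1.16] -/
def selmerDivRank [Fact p.Prime] (f : W.geomPoints →+ W'.geomPoints)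
    (hf : ∀ (σ : Field.absoluteGaloisGroup K) (P : W.geomPoints), f (σ • P) = σ • f P) : ℕ :=
  letI : Module (ZMod p)
      ((↥(selmerDivisiblePart W p ⊓ (galH1PrimaryMap p f hf).ker))[(p : ℤ)]) :=
    AddSubgroup.torsionBy.zmodModule
  Module.finrank (ZMod p) ((↥(selmerDivisiblePart W p ⊓ (galH1PrimaryMap p f hf).ker))[(p : ℤ)])

end NumberField

end Literature.NumberTheory.EllipticCurves

/-! ## Dot notation for isogenies; Smith's `r_{φ,div}(E^d)` over `ℚ` -/

namespace WeierstrassCurve.Isogeny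

open Literature.NumberTheory.EllipticCurves

variable {K : Type u} [Field K] {W W' : WeierstrassCurve K}

/-- `φ_* : H¹(K, E[p^∞]) →+ H¹(K, E'[p^∞])` for an isogeny `φ` over `K`
(`Literature.NumberTheory.EllipticCurves.galH1PrimaryMap` for `φ.toAddMonoidHom`).
Smith, arXiv:2503.17619, proof of Prop. 1.18. [folklore] -/
abbrev galH1PrimaryMap (φ : Isogeny W W') (p : ℕ) : galH1Primary W p →+ galH1Primary W' p :=
  Literature.NumberTheory.EllipticCurves.galH1PrimaryMap p φ.toAddMonoidHom φ.equivariant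

/-- `Sel_{p^∞}(φ) : Sel_{p^∞}(E/K) →+ Sel_{p^∞}(E'/K)` for an isogeny `φ` over a number field
(`Literature.NumberTheory.EllipticCurves.selmerPInftyMap`, local points maps from
`Isogeny.hasLocalPointsMaps_toAddMonoidHom`). Smith, arXiv:2503.17619, proof of Prop. 1.18
(the maps `Sel^{2^∞}_{div} E^d →(φ) Sel^{2^∞}_{div} E_0^d →(φ') Sel^{2^∞}_{div} E^d`). [folklore] -/
abbrev selmerPInftyMap [NumberField K] (φ : Isogeny W W') (p : ℕ) :
    selmerGroupPInfty W p →+ selmerGroupPInfty W' p :=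
  Literature.NumberTheory.EllipticCurves.selmerPInftyMap p φ.toAddMonoidHom φ.equivariant
    φ.hasLocalPointsMaps_toAddMonoidHom

/-- `r_{φ,div}(E)` for an isogeny `φ` over a number field and a prime `p`
(`Literature.NumberTheory.EllipticCurves.selmerDivRank` for `φ.toAddMonoidHom`).
[cite: arXiv250317619, Def. 1.16] -/
abbrev divRank [NumberField K] (φ : Isogeny W W') (p : ℕ) [Fact p.Prime] : ℕ :=
  selmerDivRank p φ.toAddMonoidHom φ.equivariant

/-- **Smith's `r_{φ,div}(E^d)`** as a function of `d ∈ ℤ` (arXiv:2503.17619, Def. 1.16, at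
`p = 2`): for a `ℚ`-isogeny `φ : E → E_0` between models with `a₁ = a₃ = 0` (Smith's
`y² = x³ + ax + b`) and `d ≠ 0`, the `div`-rank of the twisted isogeny
`φ^d : E^d → E_0^d` (`Isogeny.quadraticTwist`, "there is an associated isogeny from `E^d` to
`E_0^d` that we also denote by `φ`", Notation 1.8); junk value `0` at `d = 0` (excluded by every
statement using it). [cite: arXiv250317619, Def. 1.16] -/
def twistDivRank {W W₀ : WeierstrassCurve ℚ} [W.IsCharNeTwoNF] [W₀.IsCharNeTwoNF]
    (φ : Isogeny W W₀) (d : ℤ) : ℕ :=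
  if hd : (d : ℚ) ≠ 0 then (φ.quadraticTwist hd).divRank 2 else 0

/-- Unfolding `twistDivRank` at `d ≠ 0`. [folklore] -/
theorem twistDivRank_of_ne_zero {W W₀ : WeierstrassCurve ℚ} [W.IsCharNeTwoNF] [W₀.IsCharNeTwoNF]
    (φ : Isogeny W W₀) {d : ℤ} (hd : (d : ℚ) ≠ 0) :
    φ.twistDivRank d = (φ.quadraticTwist hd).divRank 2 := by
  rw [twistDivRank, dif_pos hd]

end WeierstrassCurve.Isogeny

end
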